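/-
Copyright (c) 2026 the pub-hodgecm-mathlib formalisation cell (harness21).  Prover seat hodgecm-mathlib-K2E4-p10 (g10), Track B «K2-LIT»,
#184♮ = hLiu418 = `stmt-HodgeConjecture-24832`; socket #41 KIND W — (KW-arch-type) THE ARCHIMEDEAN TYPE OF RECORD `t` OF THE SIEGEL CHARACTER `μ̃ = toHeckeCharacter L lam⁻¹`
FROM THE SOCKET's `HasWeight L lam 1`, WITH THE (G4) WINDOW (KW desk F0P2-p08 (g3) deal (C), 2026-09-05T00:47:56Z).
THEOREMS ONLY (no `def`, no `instance`, no notation, no named-fact hypothesis, no `sorry`).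
-/
import Literature.NumberTheory.Automorphic.Liu2021.CheckOfChiConjugateOrthogonal   -- Lit `IdeleClassGroup.HasInfinityType.inv` (⊇ Lit `ConjugateSelfDualCharacters`: `HasWeight`, `weight`, `HasInfinityType`)
import Literature.NumberTheory.Automorphic.IdeleClassCharacterHecke                 -- Lit `toHeckeCharacter`, `hasUnitaryArchType_toHeckeCharacter_iff`
import HarnessLib

/-!
# Crux `HLiu418`, socket #41, KIND W — (KW-arch-type) `K2LiuKindWArchTypeOfRecord`: THE ARCHIMEDEAN TYPE `t` OF RECORD OF `μ̃ = toHeckeCharacter L lam⁻¹` AND THE (G4) WINDOW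

Cell `hodgecm-mathlib`, crux item hLiu418 = `stmt-HodgeConjecture-24832` (helper lane `--supports … --as helper`, count-neutral), route of record `HCCMUnconditional`;
squad K2 ∕ K2Liu, road `K2_Liu`, socket #41 `sig_K2LiuSiegelEisensteinContinuation`, KIND W; KW desk F0P2-p08 (g3); consumer = K2E3-typ2 (g2)'s tie (v27 Step 0).
THE POINT.  Socket #41 quantifies a unitary idele class character `lam` with `hlam : IsConjugateSymplectic L lam` and `hwt : HasWeight L lam 1` ([Liu2021, Def. 4.3]: an ∞-type `e`
with `|e_w| = 1` at every place), and its Siegel character of record is `μ̃ := toHeckeCharacter L lam⁻¹`.  The KIND-W archimedean payers take BY VALUE a unitary archimedean type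
`t` of `μ̃` — `ht : (toHeckeCharacter L lam⁻¹).HasUnitaryArchType t 0` (★ p863520 `hintArch_of_std`, ★ p863698 `hint_of_std`, ★ p863672 ∕ p863767 `exists_frames_hex_of_std(')`) — and
K2E3-p11's `hW_of_signCases` the (G4) window `hk : ∀ w complex, −2 ≤ k w` at `k w := −(t w)`.  THIS FILE pays all three from `hwt` alone:
**`exists_archType_of_hasWeight_one (lam) (hwt : HasWeight L lam 1) : ∃ t, (toHeckeCharacter L lam⁻¹).HasUnitaryArchType t 0 ∧ (∀ w, t w = 1 ∨ t w = -1) ∧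
∀ w : {w // w.IsComplex}, (-2 : ℤ) ≤ -(t w.1)`** — with `t := −e`: `lam⁻¹` has ∞-type `−e` (Lit `HasInfinityType.inv`), hence `toHeckeCharacter L lam⁻¹` has unitary archimedean
type `(−e, 0)` (Lit dictionary `hasUnitaryArchType_toHeckeCharacter_iff`); `weight e = 1` reads `|e_w| = 1`, so `t w = ∓1` and `−(t w) = e w = ±1 ≥ −2` (the (G4) window is no real gap).
Tie (v27 Step 0): `obtain ⟨t, ht, ht1, hk⟩ := K2LiuKindWArchTypeOfRecord.exists_archType_of_hasWeight_one L lam hwt`.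
[Liu2021, Def. 4.1, Rem. 4.2, Def. 4.3], [WeilBNT1967, Ch. VII §3], [Patrikis2019, §2.1].
HONEST LABEL.  Count-neutral helper (∞-type bookkeeping); it closes no socket: `HC_CM` is proved only modulo the 7 printed citations (2 remaining named inputs:
hLiu418 = `stmt-HodgeConjecture-24832`, h413 = `stmt-HodgeConjecture-24833`) until rung 0 closes.

## References
* [Liu2021] Y. Liu, *The arithmetic inner product formula*: Def. 4.1, Remark 4.2, Def. 4.3 (∞-types, weights of conjugate self-dual characters).
* [WeilBNT1967] A. Weil, *Basic Number Theory* (1967): Ch. VII §3 (characters of the idele class group).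
* [Patrikis2019] S. Patrikis, *Variations on a theorem of Tate*, Mem. AMS (2019): §2.1 (algebraic Hecke characters and their archimedean types).
-/

set_option autoImplicit false
-- the mandated namespace repeats the single-problem summit's segment (`HodgeConjecture.HodgeConjecture`)
set_option linter.dupNamespace false

noncomputable section

open NumberField
open Literature.NumberTheory.Automorphic Literature.NumberTheory.Automorphic.IdeleClassGroup Literature.NumberTheory.GaloisRepresentations

namespace Summit.HodgeConjecture.HodgeConjecture.Cruxes.HLiu418.K2LiuKindWArchTypeOfRecord

variable (L : Type) [Field L] [NumberField L]

/-- **(KW-arch-type) THE ARCHIMEDEAN TYPE OF RECORD AND THE (G4) WINDOW.**  For a unitary idele class character `lam` of weight one (`hwt : HasWeight L lam 1`,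
[Liu2021, Def. 4.3]) there is `t : InfinitePlace L → ℤ` with: the Siegel character of record `μ̃ = toHeckeCharacter L lam⁻¹` has unitary archimedean type `(t, 0)`
(`μ̃_∞(x) = ∏_w (ι_w x_w ∕ |ι_w x_w|)^{t_w}`); `t_w = ±1` at every place; and `−2 ≤ −t_w` at every complex place (the (G4) window of the KIND-W arch sign cases).
Proof: `hwt = ⟨e, he, hw⟩`, `t := −e`; Lit `HasInfinityType.inv` + Lit `hasUnitaryArchType_toHeckeCharacter_iff`; `weight e w = |e_w| = 1`.
[cite: Liu2021, Def. 4.1, Rem. 4.2, Def. 4.3] [cite: WeilBNT1967, Ch. VII §3] [cite: Patrikis2019, §2.1] -/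
theorem exists_archType_of_hasWeight_one (lam : IdeleClassGroup L →ₜ* Circle) (hwt : HasWeight L lam 1) :
    ∃ t : InfinitePlace L → ℤ, (toHeckeCharacter L lam⁻¹).HasUnitaryArchType t 0 ∧ (∀ w, t w = 1 ∨ t w = -1) ∧
      ∀ w : {w : InfinitePlace L // w.IsComplex}, (-2 : ℤ) ≤ -(t w.1) := by
  obtain ⟨e, he, hw⟩ := hwt
  -- `|e_w| = 1` at every place
  have he1 : ∀ w, e w = 1 ∨ e w = -1 := fun w => by
    have h : (e w).natAbs = 1 := by
      have h' := congrFun hw w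
      rwa [weight_apply, Pi.one_apply] at h'
    omega
  -- `t := −e`: `lam⁻¹` has ∞-type `−e`, so `toHeckeCharacter L lam⁻¹` has unitary archimedean type `(−e, 0)`
  refine ⟨-e, (hasUnitaryArchType_toHeckeCharacter_iff L lam⁻¹ (-e)).2 he.inv, fun w => ?_, fun w => ?_⟩
  · rcases he1 w with h | h
    · exact Or.inr (by rw [Pi.neg_apply, h])
    · exact Or.inl (by rw [Pi.neg_apply, h, neg_neg])
  · rcases he1 w.1 with h | h <;> rw [Pi.neg_apply, neg_neg, h] <;> norm_num

end Summit.HodgeConjecture.HodgeConjecture.Cruxes.HLiu418.K2LiuKindWArchTypeOfRecord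

end
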